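import Summits.QuantumFields.YangMills.Theorems.BalabanUVNodesN15TwoGridTransports
import Summits.QuantumFields.YangMills.Theorems.BalabanUVNodesN15GenuineUnitKernelRate
import Summits.QuantumFields.YangMills.Theorems.BalabanUVNodesN15BackgroundGaugeSpeciesMatrix
import Summits.QuantumFields.YangMills.Theorems.BalabanUVNodesN15BackgroundV1Gauge
import HarnessLib

/-!
# Route «BalabanUVNodes», node N15 = NE2, road (c) — PROGRAMME (P-S), XXIV: THE LATTICE-LIPSCHITZ SIZE OF KING BLOCK MEANS — `‖Ā_μ(z) − Ā_μ(z − e_μ)‖ ≤ L^m·b` for a fine field with unit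
# steps `≤ b` (`Ā = gavgM` over King's pairing `prV`): the coarse grid's transporter Lipschitz letter from (3.35)'s second member (dag-n15-c g23, n15-c∕233a)

Cell `pub-ymgap`, seat `pub-ymgap-dag-n15-c` (generation g23; R134 (a), s1; HUMAN RULING D-0062; chair R424 venue).  `bears_on: R4∕N15 · K3⁸ SpineGivenEndpointR13SepCoPHV
(stmt-QuantumFields-27366)`; filed `--supports stmt-QuantumFields-27366 --as helper` — COUNT-NEUTRAL.  Theorems only; 0 `sorry`.  Imports BY NAME dag-n15-a `TwoGrid.kingPr_add_smul_unitVec`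
(`pr(z + L^me_κ) = pr z + e_κ`), `GenuineSite.card_fibre_kingPrV`, n15-c `BackgroundLayer.gavgM`, `MatrixSpecies.blockAvgV`, `VectorPiece.bshiftEquiv`.  Nothing in the tree is modified.

WHY.  n15-c∕232 needs, per grid, the lattice-Lipschitz size `ℓ` of the field with `nℓ ≤ r`.  On the fine grid (3.35)'s second member gives `ℓ′ = r/n′` directly; on the coarse grid the field is
the block mean `Ā = gavgM prV A′` over King's fibres, and the fibre over `(z − e_μ, μ)` is the fibre over `(z, μ)` translated by `−L^m e_μ` (`kingPr_add_smul_unitVec`), so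
`Ā_μ(z) − Ā_μ(z − e_μ)` is the mean of `A′(x′ + L^me_μ) − A′(x′)` — a telescoping sum of `L^m` unit steps: `‖·‖ ≤ L^m·b = L^m·r/n′ = r/L^k`, i.e. `n_c·ℓ_c = r`.
* `norm_sub_smul_steps_le` (telescoping), `fibre_kingPrV_shift` (translated fibres), ★★ **`norm_gavgM_sub_shift_le`**.

HONEST FRAMING ∕ LIMITS.  Elementary ([folklore]); MODEL carriers (King's pairing on the doubled tori); NOT [Balaban1985BackgroundPropagators] as printed; NE2⁺ NOT PRINTED; N15 of record untouched
(DISCHARGED AS CONSUMED, p687738); counts UNMOVED (typed 28∕28 · discharged 8∕27); one finite 𝕋⁴ at fixed ε per index — NOT infinite volume ∕ OS ∕ mass gap ∕ Clay.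
-/

noncomputable section

open scoped BigOperators
open Finset

namespace Summit.QuantumFields.YangMills.BalabanUVNodes.N15.Gluing

open Literature.MathematicalPhysics.QuantumFieldTheory.Balaban1983to89
open Literature.MathematicalPhysics.QuantumFieldTheory.Balaban1983to89.B5Prop11Plancherel (Tor fine unitVec)
open Literature.MathematicalPhysics.QuantumFieldTheory.Balaban1983to89.T4EtaRateCoeffDefect (fibre mem_fibre)
open Summit.QuantumFields.YangMills.BalabanUVNodes.N15.BackgroundLayer (gavgM)
open Summit.QuantumFields.YangMills.BalabanUVNodes.N15.MatrixSpecies (blockAvgV)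
open Summit.QuantumFields.YangMills.BalabanUVNodes.N15.VectorPiece (kingPr kingPrV bshiftEquiv)
open Summit.QuantumFields.YangMills.BalabanUVNodes.N15.TwoGrid (kingPr_add_smul_unitVec)
open Summit.QuantumFields.YangMills.BalabanUVNodes.N15.GenuineSite (card_fibre_kingPrV)

variable {d : ℕ} {L : ℕ} [NeZero L]

section Lip

variable (M : Fin (d + 1) → ℕ) [∀ μ, NeZero (M μ)] (k m : ℕ) {E : Type} [NormedAddCommGroup E] [NormedSpace ℝ E]

omit [∀ μ, NeZero (M μ)] [NormedSpace ℝ E] in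
/-- telescoping: `‖f(x′ + j·e_κ) − f(x′)‖ ≤ j·b` from unit steps `≤ b`. [folklore] -/
theorem norm_sub_smul_steps_le {n : ℕ} (f : Tor (fine n M) × Fin (d + 1) → E) {b : ℝ} (hstep : ∀ κ i, ‖f (bshiftEquiv M n κ i) - f i‖ ≤ b) (κ : Fin (d + 1))
    (i : Tor (fine n M) × Fin (d + 1)) (j : ℕ) : ‖f (i.1 + j • unitVec (fine n M) κ, i.2) - f i‖ ≤ j * b := by
  induction j with
  | zero => simp
  | succ j ih =>
    have h1 := hstep κ (i.1 + j • unitVec (fine n M) κ, i.2)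
    have e1 : bshiftEquiv M n κ (i.1 + j • unitVec (fine n M) κ, i.2) = (i.1 + (j + 1) • unitVec (fine n M) κ, i.2) := by
      simp only [bshiftEquiv, Equiv.coe_fn_mk, add_smul, one_smul, add_assoc]
    rw [e1] at h1
    calc ‖f (i.1 + (j + 1) • unitVec (fine n M) κ, i.2) - f i‖
        = ‖(f (i.1 + (j + 1) • unitVec (fine n M) κ, i.2) - f (i.1 + j • unitVec (fine n M) κ, i.2)) + (f (i.1 + j • unitVec (fine n M) κ, i.2) - f i)‖ := by rw [sub_add_sub_cancel]
      _ ≤ b + j * b := (norm_add_le _ _).trans (add_le_add h1 ih)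
      _ = ((j + 1 : ℕ) : ℝ) * b := by push_cast; ring

/-- translated fibres: `x′ ↦ x′ + L^me_μ` maps the fibre of `(z − e_μ, ν)` onto the fibre of `(z, ν)`. [cite: King1986, p.664 (pairing convention)] -/
theorem fibre_kingPrV_shift (μ ν : Fin (d + 1)) (z : Tor (fine (L ^ k) M)) :
    (fibre (kingPrV L k m M) (z - unitVec (fine (L ^ k) M) μ, ν)).image (fun x' : Tor (fine (L ^ m * L ^ k) M) × Fin (d + 1) => (x'.1 + L ^ m • unitVec (fine (L ^ m * L ^ k) M) μ, x'.2)) =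
      fibre (kingPrV L k m M) (z, ν) := by
  classical
  ext x
  simp only [Finset.mem_image, mem_fibre, kingPrV, Prod.mk.injEq]
  constructor
  · rintro ⟨x'', ⟨h1, h2⟩, rfl⟩
    refine ⟨?_, h2⟩
    rw [kingPr_add_smul_unitVec M L k m, h1, sub_add_cancel]
  · rintro ⟨h1, h2⟩
    refine ⟨(x.1 - L ^ m • unitVec (fine (L ^ m * L ^ k) M) μ, x.2), ⟨?_, h2⟩, ?_⟩
    · have h := kingPr_add_smul_unitVec M L k m (x.1 - L ^ m • unitVec (fine (L ^ m * L ^ k) M) μ) μ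
      rw [sub_add_cancel, h1] at h
      exact (eq_sub_of_add_eq h.symm)
    · simp

/-- ★★ **THE LATTICE-LIPSCHITZ SIZE OF KING BLOCK MEANS**: unit steps of `A′` bounded by `b` ⟹ `‖Ā_μ′(z, ν) − Ā_μ′(z − e_μ, ν)‖ ≤ L^m·b` for `Ā = gavgM prV A′`.
[cite: King1986, p.664 (pairing convention); Balaban1985BackgroundPropagators, (3.35) p.396 (the class: |∇A| small)] -/
theorem norm_gavgM_sub_shift_le (A' : Fin (d + 1) → Tor (fine (L ^ m * L ^ k) M) × Fin (d + 1) → E) {b : ℝ}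
    (hstep : ∀ μ' κ i, ‖A' μ' (bshiftEquiv M (L ^ m * L ^ k) κ i) - A' μ' i‖ ≤ b) (μ' μ ν : Fin (d + 1)) (z : Tor (fine (L ^ k) M)) :
    ‖gavgM E (Fin (d + 1)) (kingPrV L k m M) A' μ' (z, ν) - gavgM E (Fin (d + 1)) (kingPrV L k m M) A' μ' (z - unitVec (fine (L ^ k) M) μ, ν)‖ ≤ (L ^ m : ℕ) * b := by
  classical
  have hc1 := card_fibre_kingPrV (L := L) k m M (z, ν)
  have hc2 := card_fibre_kingPrV (L := L) k m M (z - unitVec (fine (L ^ k) M) μ, ν)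
  have hLm : (0 : ℝ) < ((L ^ m) ^ (d + 1) : ℕ) := by exact_mod_cast pow_pos (pow_pos (Nat.pos_of_ne_zero (NeZero.ne L)) m) (d + 1)
  set τ : Tor (fine (L ^ m * L ^ k) M) × Fin (d + 1) → Tor (fine (L ^ m * L ^ k) M) × Fin (d + 1) := fun x' => (x'.1 + L ^ m • unitVec (fine (L ^ m * L ^ k) M) μ, x'.2) with hτ
  have hinj : Set.InjOn τ ↑(fibre (kingPrV L k m M) (z - unitVec (fine (L ^ k) M) μ, ν)) := by
    intro x _ y _ h
    simp only [hτ, Prod.mk.injEq, add_left_inj] at h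
    exact Prod.ext h.1 h.2
  have hsum : ∑ x' ∈ fibre (kingPrV L k m M) (z, ν), A' μ' x' = ∑ x'' ∈ fibre (kingPrV L k m M) (z - unitVec (fine (L ^ k) M) μ, ν), A' μ' (τ x'') := by
    rw [← fibre_kingPrV_shift M k m μ ν z, Finset.sum_image hinj]
  show ‖blockAvgV (kingPrV L k m M) (A' μ') (z, ν) - blockAvgV (kingPrV L k m M) (A' μ') (z - unitVec (fine (L ^ k) M) μ, ν)‖ ≤ (L ^ m : ℕ) * b
  simp only [blockAvgV]
  rw [hc1, hc2, hsum, ← smul_sub, ← Finset.sum_sub_distrib, norm_smul, Real.norm_of_nonneg (by positivity)]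
  calc (((L ^ m) ^ (d + 1) : ℕ) : ℝ)⁻¹ * ‖∑ x'' ∈ fibre (kingPrV L k m M) (z - unitVec (fine (L ^ k) M) μ, ν), (A' μ' (τ x'') - A' μ' x'')‖
      ≤ (((L ^ m) ^ (d + 1) : ℕ) : ℝ)⁻¹ * ∑ x'' ∈ fibre (kingPrV L k m M) (z - unitVec (fine (L ^ k) M) μ, ν), ((L ^ m : ℕ) * b) := by
        refine mul_le_mul_of_nonneg_left ((norm_sum_le _ _).trans (Finset.sum_le_sum fun x'' _ => ?_)) (by positivity)
        exact norm_sub_smul_steps_le M (A' μ') (fun κ i => hstep μ' κ i) μ x'' (L ^ m)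
    _ = (L ^ m : ℕ) * b := by
        rw [Finset.sum_const, hc2, nsmul_eq_mul, ← mul_assoc, inv_mul_cancel₀ hLm.ne', one_mul]

end Lip

end Summit.QuantumFields.YangMills.BalabanUVNodes.N15.Gluing

end
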